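import Literature.Combinatorics.SimpleGraph.FormulaCells
import Literature.Combinatorics.SimpleGraph.HamiltonianRailGadgets
import Literature.Combinatorics.SimpleGraph.HamiltonianRailPlacement
import Literature.Combinatorics.SimpleGraph.HamiltonianIteratedSubstitution
import Literature.Combinatorics.SimpleGraph.HamiltonianDiamondChain
import HarnessLib

/-!
# The graph of a formula, I: the gadget family on the diamond chain

The `#SAT → #HamPath` construction, assembled from the certified pieces. For a CNF `φ` over `ℕ`
with `N` cells (literal occurrences, `FormulaCells.lean`) the base graph is the diamond chain with
`N` cells (`HamiltonianDiamondChain.lean`); cell `c` has the four slot edges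
`pa c = (5c+1, 5c+2)`, `bq c = (5c+3, 5c+4)` (used iff the state of the cell is `true`) and
`pb c = (5c+1, 5c+3)`, `aq c = (5c+2, 5c+4)` (used iff `false`). The gadgets (all rail gadgets,
`HamiltonianRailGadgets.lean`, placed by `HamiltonianRailPlacement.lean` with inner vertices
numbered from `5N + 64g` for gadget `g`):

* gadget `g < N`: if the variable of cell `g` occurs again, first at cell `c'`, the **XOR-gadget**
  on `pa g` and `pb c'` (it keeps the paths using exactly one of them: state `g` = state `c'`);
  otherwise nothing;
* gadget `N + j`, `j < |φ|`: the **OR-gadget** with `|C_j| ∈ {1,2,3}` inputs on the literal slots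
  of the cells of clause `j` (`bq` for a positive, `aq` for a negative literal: used iff the literal
  is true); clauses of other widths get nothing.

This file defines the family (`FormulaGraph.family`) and proves it valid
(`FormulaGraph.valid`: the hypotheses of the iterated substitution theorem). The count is in
`FormulaGraphCount.lean`.

## References

* M. Liśkiewicz, M. Ogihara, S. Toda, TCS 304 (2003) 129–156, §3 (proof of Lemma 4).
* M. R. Garey, D. S. Johnson, R. E. Tarjan, SIAM J. Comput. 5 (1976) 704–714.
-/

namespace Literature.Combinatorics.SimpleGraph

open Literature.Computability.Complexity FormulaCells

open scoped Classical

namespace FormulaGraph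

variable (φ : CNF ℕ)

/-! ### Slot edges of a cell -/

/-- The slot edge `p–a` of cell `c` (used iff the state is `true`). [folklore] -/
def pa (c : ℕ) : ℕ × ℕ := (5 * c + 1, 5 * c + 2)

/-- The slot edge `p–b` of cell `c` (used iff the state is `false`). [folklore] -/
def pb (c : ℕ) : ℕ × ℕ := (5 * c + 1, 5 * c + 3)

/-- The slot edge `b–q` of cell `c` (used iff the state is `true`). [folklore] -/
def bq (c : ℕ) : ℕ × ℕ := (5 * c + 3, 5 * c + 4)

/-- The slot edge `a–q` of cell `c` (used iff the state is `false`). [folklore] -/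
def aq (c : ℕ) : ℕ × ℕ := (5 * c + 2, 5 * c + 4)

/-- **The literal slot of cell `c`**: used iff the literal of the cell is true (`bq` for a positive
literal, `aq` for a negative one). [folklore] -/
def litSlot (c : ℕ) : ℕ × ℕ :=
  if polOf φ c then bq c else aq c

/-- The first numbered inner vertex of gadget `g`. [folklore] -/
def base (g : ℕ) : ℕ :=
  5 * N φ + 64 * g

/-- The literal slot of a cell lies in the chain. [folklore] -/
theorem litSlot_fst_lt {c : ℕ} (hc : c < N φ) : (litSlot φ c).1 < 5 * N φ ∧ (litSlot φ c).2 < 5 * N φ := by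
  unfold litSlot bq aq; split_ifs <;> dsimp only <;> omega

/-- The literal slot of a cell lies in the right half of the cell. [folklore] -/
theorem litSlot_bounds (c : ℕ) : 5 * c + 2 ≤ (litSlot φ c).1 ∧ (litSlot φ c).1 < (litSlot φ c).2 ∧ (litSlot φ c).2 = 5 * c + 4 := by
  unfold litSlot bq aq; split_ifs <;> dsimp only <;> omega

/-! ### The placements -/

/-- The next occurrence of the variable of cell `g`, with its bounds. [folklore] -/
noncomputable def nextSub (g : ℕ) : Option {c' : ℕ // g < c' ∧ c' < N φ} :=
  if h : ∃ c', next? φ g = some c' then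
    some ⟨Classical.choose h, (next?_spec φ (Classical.choose_spec h)).1, (next?_spec φ (Classical.choose_spec h)).2.1⟩
  else none

/-- `nextSub` carries the value of `next?`. [folklore] -/
theorem nextSub_val (g : ℕ) : (nextSub φ g).map Subtype.val = next? φ g := by
  unfold nextSub
  split_ifs with h
  · obtain ⟨c', hc'⟩ := h
    have := Classical.choose_spec (p := fun c' => next? φ g = some c') ⟨c', hc'⟩
    simp only [Option.map_some]
    exact this.symm
  · cases hn : next? φ g with
    | none => rfl
    | some c' => exact absurd ⟨c', hn⟩ h

/-- **The XOR placement** for cell `c` and the next occurrence `c'` of its variable: the XOR-gadget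
on `pa c` and `pb c'`. [folklore] -/
@[reducible] def xorPlacement (c : ℕ) (c' : {c' : ℕ // c < c' ∧ c' < N φ}) : RailPlacement where
  k := 2
  K := 4
  m := 4
  Γ := RailXOR.Γ
  base := base φ c
  ends r := if r = 0 then pa c else pb c'.val
  ends_lt r := by
    have := c'.property
    unfold base pa pb; split_ifs <;> simp <;> omega
  ends_ne r := by
    unfold pa pb; split_ifs <;> simp
  ends_distinct r r' hrr := by
    have hc := c'.property
    have : ∀ s : Fin 2, s = 0 ∨ s = 1 := by decide
    rcases this r with rfl | rfl <;> rcases this r' with rfl | rfl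
    · exact absurd rfl hrr
    · simp only [↓reduceIte, Fin.one_eq_zero_iff, OfNat.ofNat_ne_one, pa, pb, ne_eq]; omega
    · simp only [Fin.one_eq_zero_iff, OfNat.ofNat_ne_one, ↓reduceIte, pb, pa, ne_eq]; omega
    · exact absurd rfl hrr

/-- **A clause placement**: a `k`-input OR-gadget template on the literal slots of the first `k`
cells of clause `j` (used with `k = |C_j|`). [folklore] -/
@[reducible] def clausePlacement {k K m : ℕ} (Γ : RailGadget k K m) (j : ℕ) (hj : j < φ.length) (hk : k ≤ φ[j].length) (g : ℕ) :
    RailPlacement where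
  k := k
  K := K
  m := m
  Γ := Γ
  base := base φ g
  ends r := litSlot φ (start φ j + r.val)
  ends_lt r := by
    have := litSlot_fst_lt φ (start_add_lt φ hj (lt_of_lt_of_le r.isLt hk))
    unfold base; omega
  ends_ne r := by
    have := litSlot_bounds φ (start φ j + r.val); omega
  ends_distinct r r' hrr := by
    have h1 := litSlot_bounds φ (start φ j + r.val)
    have h2 := litSlot_bounds φ (start φ j + r'.val)
    have : r.val ≠ r'.val := fun h => hrr (Fin.ext h)
    omega

/-- **The clause placement of gadget `g = N + j`** (`none` unless `|C_j| ∈ {1, 2, 3}`). [folklore] -/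
noncomputable def clausePlace (g : ℕ) : Option RailPlacement :=
  if hj : g - N φ < φ.length then
    if h1 : φ[g - N φ].length = 1 then some (clausePlacement φ RailOR1.Γ (g - N φ) hj (by omega) g)
    else if h2 : φ[g - N φ].length = 2 then some (clausePlacement φ RailOR2.Γ (g - N φ) hj (by omega) g)
    else if h3 : φ[g - N φ].length = 3 then some (clausePlacement φ RailOR3.Γ (g - N φ) hj (by omega) g)
    else none
  else none

/-- **The placement of gadget `g`** (`none`: no gadget). [folklore] -/
noncomputable def place (g : ℕ) : Option RailPlacement :=
  if g < N φ then (nextSub φ g).map (xorPlacement φ g) else clausePlace φ g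

/-- **The gadget family of `φ`.** [folklore] -/
noncomputable def family : GadgetFamily ℕ where
  S g := (place φ g).elim ∅ RailPlacement.S
  GX g := (place φ g).elim ⊥ RailPlacement.GX
  VX g := (place φ g).elim ∅ RailPlacement.VX

/-- The number of gadgets. [folklore] -/
def numGadgets : ℕ :=
  N φ + φ.length

/-! ### Arithmetic of cells and slots -/

/-- The first cell of the next clause. [folklore] -/
theorem start_succ {j : ℕ} (hj : j < φ.length) : start φ (j + 1) = start φ j + φ[j].length := by
  rw [start, start, List.take_add_one, List.getElem?_eq_getElem hj, Option.toList_some, List.flatten_append]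
  simp

/-- `start` is monotone. [folklore] -/
theorem start_mono {j j' : ℕ} (h : j ≤ j') (hj' : j' ≤ φ.length) : start φ j ≤ start φ j' := by
  induction j' with
  | zero => simp at h; subst h; exact le_refl _
  | succ j' ih =>
    rcases Nat.lt_or_ge j (j' + 1) with hlt | hge
    · exact (ih (by omega) (by omega)).trans (by rw [start_succ φ (by omega)]; omega)
    · have : j = j' + 1 := by omega
      subst this; exact le_refl _

/-- **A cell lies in only one clause.** [folklore] -/
theorem clause_unique {j j' r r' : ℕ} (hj : j < φ.length) (hj' : j' < φ.length) (hr : r < φ[j].length)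
    (hr' : r' < φ[j'].length) (h : start φ j + r = start φ j' + r') : j = j' ∧ r = r' := by
  rcases Nat.lt_trichotomy j j' with hlt | rfl | hgt
  · have h1 := start_succ φ hj
    have h2 := start_mono φ (show j + 1 ≤ j' by omega) hj'.le
    omega
  · exact ⟨rfl, by omega⟩
  · have h1 := start_succ φ hj'
    have h2 := start_mono φ (show j' + 1 ≤ j by omega) hj.le
    omega

/-- **The previous occurrence is unique**: two cells with the same next occurrence coincide.
[folklore] -/
theorem next?_inj {g g' c' : ℕ} (h : next? φ g = some c') (h' : next? φ g' = some c') : g = g' := by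
  obtain ⟨h1, -, h3, h4⟩ := next?_spec φ h
  obtain ⟨h1', -, h3', h4'⟩ := next?_spec φ h'
  by_contra hne
  rcases Nat.lt_or_gt_of_ne hne with hlt | hgt
  · exact h4 g' hlt h1' (h3'.symm.trans h3)
  · exact h4' g hgt h1 (h3.symm.trans h3')

/-- The slot edges a gadget is meant to own. [folklore] -/
def IsSlotOf (g : ℕ) (e : ℕ × ℕ) : Prop :=
  (g < N φ ∧ (e = pa g ∨ ∃ c', next? φ g = some c' ∧ e = pb c')) ∨
    (∃ j, ∃ hj : j < φ.length, g = N φ + j ∧ ∃ r < φ[j].length, e = litSlot φ (start φ j + r))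

/-- Meant slot edges are increasing pairs. [folklore] -/
theorem fst_lt_snd_of_isSlotOf {g : ℕ} {e : ℕ × ℕ} (h : IsSlotOf φ g e) : e.1 < e.2 := by
  rcases h with ⟨-, rfl | ⟨c', -, rfl⟩⟩ | ⟨j, -, -, r, -, rfl⟩
  · simp [pa]
  · simp [pb]
  · exact (litSlot_bounds φ _).2.1

/-- **A slot edge is meant for only one gadget.** [folklore] -/
theorem isSlotOf_unique {g g' : ℕ} {e : ℕ × ℕ} (h : IsSlotOf φ g e) (h' : IsSlotOf φ g' e) : g = g' := by
  rcases h with ⟨hg, rfl | ⟨c', hc', rfl⟩⟩ | ⟨j, hj, rfl, r, hr, rfl⟩ <;>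
    rcases h' with ⟨hg', he | ⟨c'', hc'', he⟩⟩ | ⟨j', hj', rfl, r', hr', he⟩
  · simp only [pa, Prod.mk.injEq] at he; omega
  · simp only [pa, pb, Prod.mk.injEq] at he; omega
  · have := litSlot_bounds φ (start φ j' + r'); simp only [pa] at he; rw [← he] at this; simp at this; omega
  · simp only [pa, pb, Prod.mk.injEq] at he; omega
  · simp only [pb, Prod.mk.injEq] at he
    have : c' = c'' := by omega
    subst this
    exact next?_inj φ hc' hc''
  · have := litSlot_bounds φ (start φ j' + r'); simp only [pb] at he; rw [← he] at this; simp at this; omega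
  · have := litSlot_bounds φ (start φ j + r); simp only [pa] at he; rw [he] at this; simp at this; omega
  · have := litSlot_bounds φ (start φ j + r); simp only [pb] at he; rw [he] at this; simp at this; omega
  · have h1 := litSlot_bounds φ (start φ j + r)
    have h2 := litSlot_bounds φ (start φ j' + r')
    rw [he] at h1
    have hcell : start φ j + r = start φ j' + r' := by omega
    rw [(clause_unique φ hj hj' hr hr' hcell).1]

/-! ### The placements, case by case -/

/-- The cases of `place`. [folklore] -/
theorem place_cases (g : ℕ) :
    place φ g = none ∨
      (∃ c' : {c' : ℕ // g < c' ∧ c' < N φ}, g < N φ ∧ next? φ g = some c'.val ∧ place φ g = some (xorPlacement φ g c')) ∨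
      (∃ j, ∃ hj : j < φ.length, g = N φ + j ∧
        ((∃ h, place φ g = some (clausePlacement φ RailOR1.Γ j hj h g)) ∨
          (∃ h, place φ g = some (clausePlacement φ RailOR2.Γ j hj h g)) ∨
          (∃ h, place φ g = some (clausePlacement φ RailOR3.Γ j hj h g)))) := by
  unfold place
  by_cases hg : g < N φ
  · rw [if_pos hg]
    cases hn : nextSub φ g with
    | none => left; rfl
    | some c' =>
      right; left
      refine ⟨c', hg, ?_, rfl⟩
      have := nextSub_val φ g
      rw [hn, Option.map_some] at this
      exact this.symm
  · rw [if_neg hg]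
    unfold clausePlace
    by_cases hj : g - N φ < φ.length
    · simp only [hj, ↓reduceDIte]
      by_cases h1 : φ[g - N φ].length = 1
      · right; right
        exact ⟨g - N φ, hj, by omega, Or.inl ⟨by omega, by simp [h1]⟩⟩
      · by_cases h2 : φ[g - N φ].length = 2
        · right; right
          exact ⟨g - N φ, hj, by omega, Or.inr (Or.inl ⟨by omega, by simp [h2]⟩)⟩
        · by_cases h3 : φ[g - N φ].length = 3
          · right; right
            exact ⟨g - N φ, hj, by omega, Or.inr (Or.inr ⟨by omega, by simp [h3]⟩)⟩
          · left; simp [h1, h2, h3]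
    · left; simp [hj]

/-- A placed gadget of `φ`, whatever its template: block from `base φ g`, at most 64 inner vertices,
its slots are meant for `g`, and its template is exclusive. [folklore] -/
theorem place_spec {g : ℕ} {P : RailPlacement} (hP : place φ g = some P) :
    P.base = base φ g ∧ P.k * P.K + P.m ≤ 64 ∧ (∀ e ∈ P.S, IsSlotOf φ g e) ∧
      Exclusive P.Γ.graph P.Γ.VX P.Γ.slots := by
  rcases place_cases φ g with h | ⟨c', hg, hn, h⟩ | ⟨j, hj, rfl, ⟨hk, h⟩ | ⟨hk, h⟩ | ⟨hk, h⟩⟩ <;>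
    rw [hP] at h <;> simp only [Option.some.injEq, reduceCtorEq] at h <;> subst h
  · refine ⟨rfl, show 2 * 4 + 4 ≤ 64 by decide, fun e he => ?_, RailXOR.exclusive⟩
    obtain ⟨r, rfl⟩ := (RailPlacement.mem_S_iff _).1 he
    left
    refine ⟨hg, ?_⟩
    have : ∀ s : Fin 2, s = 0 ∨ s = 1 := by decide
    rcases this r with rfl | rfl
    · exact Or.inl rfl
    · exact Or.inr ⟨c'.val, hn, rfl⟩
  · refine ⟨rfl, show 1 * 2 + 1 ≤ 64 by decide, fun e he => ?_, RailOR1.exclusive⟩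
    obtain ⟨r, rfl⟩ := (RailPlacement.mem_S_iff _).1 he
    exact Or.inr ⟨j, hj, rfl, r.val, lt_of_lt_of_le r.isLt hk, rfl⟩
  · refine ⟨rfl, show 2 * 6 + 6 ≤ 64 by decide, fun e he => ?_, RailOR2.exclusive⟩
    obtain ⟨r, rfl⟩ := (RailPlacement.mem_S_iff _).1 he
    exact Or.inr ⟨j, hj, rfl, r.val, lt_of_lt_of_le r.isLt hk, rfl⟩
  · refine ⟨rfl, show 3 * 6 + 9 ≤ 64 by decide, fun e he => ?_, RailOR3.exclusive⟩
    obtain ⟨r, rfl⟩ := (RailPlacement.mem_S_iff _).1 he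
    exact Or.inr ⟨j, hj, rfl, r.val, lt_of_lt_of_le r.isLt hk, rfl⟩

/-- `clausePlace` written with the clause index. [folklore] -/
theorem clausePlace_eq (g j : ℕ) (hgj : g - N φ = j) (hj : j < φ.length) :
    clausePlace φ g =
      if h1 : φ[j].length = 1 then some (clausePlacement φ RailOR1.Γ j hj (by omega) g)
      else if h2 : φ[j].length = 2 then some (clausePlacement φ RailOR2.Γ j hj (by omega) g)
      else if h3 : φ[j].length = 3 then some (clausePlacement φ RailOR3.Γ j hj (by omega) g)
      else none := by
  subst hgj
  unfold clausePlace
  rw [dif_pos hj]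

/-- `place` on a clause gadget, written with the clause index. [folklore] -/
theorem place_clause_eq (j : ℕ) (hj : j < φ.length) :
    place φ (N φ + j) =
      if h1 : φ[j].length = 1 then some (clausePlacement φ RailOR1.Γ j hj (by omega) (N φ + j))
      else if h2 : φ[j].length = 2 then some (clausePlacement φ RailOR2.Γ j hj (by omega) (N φ + j))
      else if h3 : φ[j].length = 3 then some (clausePlacement φ RailOR3.Γ j hj (by omega) (N φ + j))
      else none := by
  unfold place
  rw [if_neg (by omega)]
  exact clausePlace_eq φ (N φ + j) j (by omega) hj

/-- `place` on a cell, written with `nextSub`. [folklore] -/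
theorem place_cell_eq {g : ℕ} (hg : g < N φ) : place φ g = (nextSub φ g).map (xorPlacement φ g) := by
  unfold place
  rw [if_pos hg]

/-! ### Validity -/

/-- The slots of the family. [folklore] -/
@[simp] theorem family_S (g : ℕ) : (family φ).S g = (place φ g).elim ∅ RailPlacement.S := rfl
/-- The gadget graphs of the family. [folklore] -/
@[simp] theorem family_GX (g : ℕ) : (family φ).GX g = (place φ g).elim ⊥ RailPlacement.GX := rfl
/-- The gadget vertices of the family. [folklore] -/
@[simp] theorem family_VX (g : ℕ) : (family φ).VX g = (place φ g).elim ∅ RailPlacement.VX := rfl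

/-- The slots of gadget `g` are meant for `g`. [folklore] -/
theorem isSlotOf_of_mem_S {g : ℕ} {e : ℕ × ℕ} (he : e ∈ (family φ).S g) : IsSlotOf φ g e := by
  rw [family_S] at he
  cases hP : place φ g with
  | none => rw [hP] at he; simp at he
  | some P => rw [hP] at he; exact (place_spec φ hP).2.2.1 e he

/-- The gadget vertices of gadget `g` lie in its block. [folklore] -/
theorem mem_VX_bounds {g v : ℕ} (hv : v ∈ (family φ).VX g) : base φ g ≤ v ∧ v < base φ g + 64 := by
  rw [family_VX] at hv
  cases hP : place φ g with
  | none => rw [hP] at hv; simp at hv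
  | some P =>
    rw [hP] at hv
    obtain ⟨hb, hsize, -⟩ := place_spec φ hP
    have := P.mem_VX_bounds hv
    omega

/-- The four slot edges of a cell are edges of the diamond chain. [folklore] -/
theorem chain_adj_slots {c : ℕ} (hc : c < N φ) :
    (chainG (N φ)).Adj (5 * c + 1) (5 * c + 2) ∧ (chainG (N φ)).Adj (5 * c + 1) (5 * c + 3) ∧
      (chainG (N φ)).Adj (5 * c + 3) (5 * c + 4) ∧ (chainG (N φ)).Adj (5 * c + 2) (5 * c + 4) := by
  have h1 : (5 * c + 1) % 5 = 1 := by omega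
  have h2 : (5 * c + 2) % 5 = 2 := by omega
  have h3 : (5 * c + 3) % 5 = 3 := by omega
  refine ⟨?_, ?_, ?_, ?_⟩ <;> rw [chainG_adj, chainRelB_iff] <;> refine ⟨by omega, Or.inl ⟨by omega, ?_⟩⟩
  · exact Or.inr (Or.inl ⟨h1, Or.inl rfl⟩)
  · exact Or.inr (Or.inl ⟨h1, Or.inr rfl⟩)
  · exact Or.inr (Or.inr (Or.inr (Or.inl ⟨h3, rfl⟩)))
  · exact Or.inr (Or.inr (Or.inl ⟨h2, Or.inr rfl⟩))

/-- Meant slot edges are edges of the diamond chain between chain vertices. [folklore] -/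
theorem chain_adj_of_isSlotOf {g : ℕ} {e : ℕ × ℕ} (h : IsSlotOf φ g e) :
    e.1 < 5 * N φ ∧ e.2 < 5 * N φ ∧ (chainG (N φ)).Adj e.1 e.2 := by
  rcases h with ⟨hg, rfl | ⟨c', hc', rfl⟩⟩ | ⟨j, hj, rfl, r, hr, rfl⟩
  · exact ⟨by simp [pa]; omega, by simp [pa]; omega, (chain_adj_slots φ hg).1⟩
  · have hc := (next?_spec φ hc').2.1
    exact ⟨by simp [pb]; omega, by simp [pb]; omega, (chain_adj_slots φ hc).2.1⟩
  · have hc := start_add_lt φ hj hr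
    refine ⟨(litSlot_fst_lt φ hc).1, (litSlot_fst_lt φ hc).2, ?_⟩
    unfold litSlot bq aq
    split_ifs
    · exact (chain_adj_slots φ hc).2.2.1
    · exact (chain_adj_slots φ hc).2.2.2

/-- Gadget vertices are fresh. [folklore] -/
theorem V_disjoint (g : ℕ) : Disjoint (chainV (N φ)) ((family φ).VX g) := by
  rw [Finset.disjoint_left]
  intro v hv hv'
  simp only [chainV, Finset.mem_range] at hv
  have := (mem_VX_bounds φ hv').1
  unfold base at this; omega

/-- Gadget vertex blocks are pairwise disjoint. [folklore] -/
theorem VX_disjoint {g g' : ℕ} (hne : g ≠ g') : Disjoint ((family φ).VX g) ((family φ).VX g') := by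
  rw [Finset.disjoint_left]
  intro v hv hv'
  have h1 := mem_VX_bounds φ hv
  have h2 := mem_VX_bounds φ hv'
  unfold base at h1 h2
  rcases Nat.lt_or_gt_of_ne hne with h | h
  · have : 64 * g + 64 ≤ 64 * g' := by omega
    omega
  · have : 64 * g' + 64 ≤ 64 * g := by omega
    omega

/-- Slots are chain edges inside the chain. [folklore] -/
theorem slot_adj {g : ℕ} {e : ℕ × ℕ} (he : e ∈ (family φ).S g) :
    e.1 ∈ chainV (N φ) ∧ e.2 ∈ chainV (N φ) ∧ (chainG (N φ)).Adj e.1 e.2 := by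
  obtain ⟨h1, h2, h3⟩ := chain_adj_of_isSlotOf φ (isSlotOf_of_mem_S φ he)
  exact ⟨by simpa [chainV] using h1, by simpa [chainV] using h2, h3⟩

/-- Slots of different gadgets are different edges. [folklore] -/
theorem slot_across {g g' : ℕ} (hne : g ≠ g') {e : ℕ × ℕ} (he : e ∈ (family φ).S g) : ¬ slotOf ((family φ).S g') e.1 e.2 := by
  have hg := isSlotOf_of_mem_S φ he
  rintro (h | h)
  · exact hne (isSlotOf_unique φ hg (isSlotOf_of_mem_S φ h))
  · have h1 := fst_lt_snd_of_isSlotOf φ hg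
    have h2 := fst_lt_snd_of_isSlotOf φ (isSlotOf_of_mem_S φ h)
    simp at h2; omega

/-- Slots of one gadget have pairwise distinct ends. [folklore] -/
theorem slot_disjoint (g : ℕ) : ∀ e ∈ (family φ).S g, ∀ e' ∈ (family φ).S g, e ≠ e' →
    e.1 ≠ e'.1 ∧ e.1 ≠ e'.2 ∧ e.2 ≠ e'.1 ∧ e.2 ≠ e'.2 := by
  intro e he e' he' hne
  rw [family_S] at he he'
  cases hP : place φ g with
  | none => rw [hP] at he; simp at he
  | some P =>
    rw [hP] at he he'
    obtain ⟨r, rfl⟩ := (RailPlacement.mem_S_iff P).1 he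
    obtain ⟨r', rfl⟩ := (RailPlacement.mem_S_iff P).1 he'
    exact P.ends_distinct r r' fun h => hne (by rw [h])

/-- Gadget edges attach to ports only. [folklore] -/
theorem gadget_adj (g : ℕ) : ∀ a b, ((family φ).GX g).Adj a b →
    (a ∈ (family φ).VX g ∨ b ∈ (family φ).VX g) ∧ (a ∈ (family φ).VX g ∨ a ∈ ports ((family φ).S g)) ∧
      (b ∈ (family φ).VX g ∨ b ∈ ports ((family φ).S g)) := by
  intro a b hab
  rw [family_GX] at hab
  rw [family_VX, family_S]
  cases hP : place φ g with
  | none => rw [hP] at hab; exact absurd hab (by simp)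
  | some P => rw [hP] at hab; exact P.gadget_adj a b hab

/-- One port edge at each port. [folklore] -/
theorem port_unique (g : ℕ) : ∀ p ∈ ports ((family φ).S g), ∀ x y, ((family φ).GX g).Adj p x →
    ((family φ).GX g).Adj p y → x = y := by
  intro p hp x y hx hy
  rw [family_S] at hp
  rw [family_GX] at hx hy
  cases hP : place φ g with
  | none => rw [hP] at hx; exact absurd hx (by simp)
  | some P => rw [hP] at hp hx hy; exact P.port_unique p hp x y hx hy

/-- Every gadget is exclusive. [folklore] -/
theorem exclusive (g : ℕ) : Exclusive ((family φ).GX g) ((family φ).VX g) ((family φ).S g) := by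
  rw [family_S, family_GX, family_VX]
  cases hP : place φ g with
  | none =>
    intro T h1 _ _ _ τ hτ
    exact absurd (h1 τ hτ).1 (by simp [ports])
  | some P => exact P.exclusive (place_spec φ hP).2.2.2

/-- **The gadget family of a formula is valid.** [folklore] -/
theorem valid (n : ℕ) : GadgetFamily.Valid (chainG (N φ)) (chainV (N φ)) (family φ) n :=
  ⟨fun g _ => V_disjoint φ g, fun _ _ _ _ hne => VX_disjoint φ hne, fun _ _ _ he => slot_adj φ he,
    fun _ _ _ _ hne _ he => slot_across φ hne he, fun g _ => slot_disjoint φ g, fun g _ => gadget_adj φ g,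
    fun g _ => port_unique φ g, fun g _ => exclusive φ g⟩

end FormulaGraph

end Literature.Combinatorics.SimpleGraph
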